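/-
Copyright (c) 2026 the pub-hodgecm-mathlib formalisation cell (harness21).  Prover seat hodgecm-mathlib-K2E4-p09 (g3), Track B «K2-LIT» ∕ h413, road (d-w) of ‹J3› v2, letter (C-ratio),
brick (C1-I) «IWAHORI LEVEL COUNT» (road owner K2E3-p03 (g3) ORDERS 2026-09-04T03:29:34Z), FILE 1: coset bookkeeping in `U(σ, antidiag(1,1)) ≤ GL₂(K)` over a valued field.  2026-09-04.
-/
import Literature.NumberTheory.Automorphic.UnitaryTwoAntidiagCornerFactorisation   -- ★ (C1) structure file (K2E3-p03 (g3)): entry relations, `SU` by entries, the torus `diag(e, (σe)⁻¹)`, `|det| = 1`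
import Mathlib.GroupTheory.Index
import Mathlib.GroupTheory.QuotientGroup.Basic
import HarnessLib

/-!
# `U(σ, antidiag(1,1))` over a valued field: inverse entries, the three one-parameter subgroups, the level subgroups `K⁰ ⊇ I ⊇ B(4) ⊇ N(4)K(4) ⊇ K(4)`, and
# the coset-counting lemma `[H₁ : H₀] = [B : B₀]` for `H₁ = φ(B)·H₀`
# (Tits 1979 §3.3.1, §3.7; Cartier 1979 §III.5 (Iwahori factorisation); Serre, *Local Fields* IV §2)

Topic `NumberTheory/Automorphic`; namespace `Literature.NumberTheory.Automorphic.UnitaryGroup`.  THEOREMS ONLY (no definition, no instance, no notation, no named fact, no `sorry`);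
kernel lane `--supports stmt-HodgeConjecture-24833`.  Cell `pub/hodgecm-mathlib`, Track B «K2-LIT», crux H413; road (d-w) of ‹J3› v2 (owner K2E3-p03 (g3)), letter (C-ratio) ⟸ (C1)+(C2),
brick **(C1-I) «IWAHORI LEVEL COUNT»** `[I : K⁰(4)] = (q−1)·q^{8m−2}` (√u) ∕ `(q−1)·q^{8m−1}` (√π) of `K2/K2E3-p03/g3/TARGETS-Cratio.K2E3-p03-g3.md` (with ★ F6∕F7 `[K⁰ : I]` this gives the
(C1) cand `N_iso = [K⁰ : K⁰(4)]`).  FILE 1 (this file) = field-generic COSET BOOKKEEPING in the one-place model `U := unitaryGroupOfForm σ !![0,1;1,0] ≤ GL₂(K)` of ★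
`UnitaryTwoAntidiagCornerFactorisation`; FILE 2 (`UnitaryTwoAntidiagIwahoriLevelIndices`) = the three index identities `[N(𝒪⁻)K(4) : K(4)] = [𝒪⁻ : (4𝒪)⁻]`, `[B(4) : N(𝒪⁻)K(4)] =
[𝒪^× : 1+4𝒪]`, `[I : B(4)] = [𝔪⁻ : (4𝒪)⁻]`; FILE 3 (Summits-side) = the CM dress and the numbers.  Everything over a FIELD `K` with a ring endomorphism `σ` (involutive ∕ isometric
where stated) and `Valued K ℤᵐ⁰`; all subgroups are BINDERS with membership letters (define-free), their EXISTENCE proved here.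

THE MATHEMATICS (`g = (a b; c d) ∈ U`, `|·| = Valued.v`, «`x ≡ y (4)`» means `|x − y| ≤ |4|`).  §0 the abstract count: for a hom `φ : A → G`, subgroups `B₀ ≤ B ≤ A`, `H₀ ≤ H₁ ≤ G` with
`φ(B) ≤ H₁`, `φ(b) ∈ H₀ ↔ b ∈ B₀` on `B`, and `H₁ ⊆ φ(B)·H₀`, the map `B∕B₀ → H₁∕H₀` is a bijection, so **`[H₁ : H₀] = [B : B₀]`** (`relIndex_eq_relIndex_of_mul_decomposition`; no
normality needed — the Iwahori steps are not normal).  §1 `g⁻¹ = Φ·ᵗ(σg)·Φ`, i.e. `(g⁻¹)₀₀ = σd`, `(g⁻¹)₀₁ = σb`, `(g⁻¹)₁₀ = σc`, `(g⁻¹)₁₁ = σa` (`coe_inv_apply_of_mem_unitaryGroupOfForm_antidiagTwo`).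
§2 the one-parameter homomorphisms `n : (K,+) → GL₂`, `x ↦ (1 x; 0 1)`, `n̄ : x ↦ (1 0; x 1)`, `t : K^× → GL₂`, `e ↦ diag(e, (σe)⁻¹)` (existence + injectivity; `n(x), n̄(x) ∈ U ↔ σx = −x`,
`t(e) ∈ U`).  §3 the LEVEL SUBGROUPS as `{g ∈ U | entry conditions}` (existence): `K⁰` (all `|gᵢⱼ| ≤ 1`), `K(4)` (`K⁰`, `g ≡ 1 (4)`), `H₁ = N(𝒪⁻)·K(4)` (`K⁰`, `a ≡ d ≡ 1`, `c ≡ 0 (4)`),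
`H₂ = B(4)` (`K⁰`, `c ≡ 0 (4)`), `I` (`K⁰`, `|c| < 1`) — closure under products by the ultrametric inequality on `(gh)ᵢⱼ = Σ gᵢₖhₖⱼ`, under inverses by §1 and `|σx| = |x|`; and the
chain `K(4) ≤ H₁ ≤ H₂ ≤ I` when `|4| < 1`.
HONEST LABEL: count-neutral field∕group algebra; HC_CM is proved only modulo the 7 printed citations (2 remaining named inputs: hLiu418 = `stmt-HodgeConjecture-24832`, h413 =
`stmt-HodgeConjecture-24833`) until rung 0 closes; (C1)∕(C-ratio) are NOT proved here.

## References
* [Tits1979] J. Tits, *Reductive groups over local fields*, PSPM 33.1 (1979), §3.3.1 (Iwahori factorisation), §3.7, §3.9 (ramified `U(1,1)`).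
* [CartierCorvallis1979] P. Cartier, *Representations of 𝔭-adic groups: a survey*, PSPM 33.1 (1979), §III.5 (the big-cell decomposition of an Iwahori subgroup).
* [Serre1979] J.-P. Serre, *Local Fields*, GTM 67 (1979), Ch. IV §2 Prop. 6 (the filtration `U ⊃ U¹ ⊃ …`).
* [Rogawski1990] J. D. Rogawski, *Automorphic Representations of Unitary Groups in Three Variables*, Ann. of Math. Stud. 123 (1990), §1.9–§1.10 pp. 8–9.
-/

set_option autoImplicit false

open scoped Matrix MatrixGroups
open Matrix WithZero

namespace Literature.NumberTheory.Automorphic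

namespace UnitaryGroup

/-! ## §0 The coset count `[H₁ : H₀] = [B : B₀]` for `H₁ = φ(B)·H₀` -/

section Cosets

variable {G A : Type*} [Group G] [Group A]

/-- **COSET COUNT ALONG A ONE-PARAMETER SUBGROUP.**  Let `φ : A →* G`, `B₀, B ≤ A`, `H₀, H₁ ≤ G` with `φ(B) ⊆ H₁`, `φ b ∈ H₀ ↔ b ∈ B₀` for `b ∈ B`, and every `h ∈ H₁` of the form
`φ(b)·h₀` (`b ∈ B`, `h₀ ∈ H₀`).  Then `b B₀ ↦ φ(b) H₀` is a bijection `B∕B₀ ≃ H₁∕H₀`, so **`[H₁ : H₀] = [B : B₀]`** (`H₀` need NOT be normal in `H₁`).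
[cite: CartierCorvallis1979, §III.5] [cite: Tits1979, §3.3.1] -/
theorem relIndex_eq_relIndex_of_mul_decomposition (φ : A →* G) (B₀ B : Subgroup A) (H₀ H₁ : Subgroup G)
    (hB : ∀ b ∈ B, φ b ∈ H₁) (hB₀ : ∀ b ∈ B, (φ b ∈ H₀ ↔ b ∈ B₀))
    (hcov : ∀ h ∈ H₁, ∃ b ∈ B, (φ b)⁻¹ * h ∈ H₀) : H₀.relIndex H₁ = B₀.relIndex B := by
  classical
  let ι : ↥B → ↥H₁ := fun b => ⟨φ b, hB b b.2⟩
  let f : ↥B → ↥H₁ ⧸ H₀.subgroupOf H₁ := fun b => (QuotientGroup.mk (ι b) : ↥H₁ ⧸ H₀.subgroupOf H₁)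
  have hf : ∀ b b' : ↥B, f b = f b' ↔ b⁻¹ * b' ∈ B₀.subgroupOf B := by
    intro b b'
    simp only [f, QuotientGroup.eq, Subgroup.mem_subgroupOf]
    change (φ b)⁻¹ * φ b' ∈ H₀ ↔ ((b : A)⁻¹ * (b' : A)) ∈ B₀
    rw [← map_inv, ← map_mul]
    exact hB₀ _ (B.mul_mem (B.inv_mem b.2) b'.2)
  let g : ↥B ⧸ B₀.subgroupOf B → ↥H₁ ⧸ H₀.subgroupOf H₁ :=
    Quotient.lift f (fun a b hab => (hf a b).2 (QuotientGroup.leftRel_apply.mp hab))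
  have hg : ∀ b : ↥B, g (QuotientGroup.mk b) = f b := fun _ => rfl
  have hinj : Function.Injective g := by
    intro x y
    induction x using QuotientGroup.induction_on with | H a => ?_
    induction y using QuotientGroup.induction_on with | H b => ?_
    intro h
    rw [hg, hg] at h
    exact QuotientGroup.eq.2 ((hf a b).1 h)
  have hsurj : Function.Surjective g := by
    intro y
    induction y using QuotientGroup.induction_on with | H h => ?_
    obtain ⟨b, hb, hbh⟩ := hcov h h.2
    refine ⟨QuotientGroup.mk ⟨b, hb⟩, ?_⟩
    rw [hg]
    simp only [f]
    refine QuotientGroup.eq.2 ?_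
    rw [Subgroup.mem_subgroupOf]
    exact hbh
  rw [Subgroup.relIndex, Subgroup.relIndex, Subgroup.index, Subgroup.index]
  exact (Nat.card_congr (Equiv.ofBijective g ⟨hinj, hsurj⟩)).symm

end Cosets

/-! ## §1 Inverse entries in `U(σ, antidiag(1,1))` -/

section Inverse

variable {K : Type*} [Field K] (σ : K →+* K)

/-- **`g⁻¹ = Φ·ᵗ(σg)·Φ` BY ENTRIES** for `g ∈ U(σ, antidiag(1,1))`: `(g⁻¹)₀₀ = σ g₁₁`, `(g⁻¹)₀₁ = σ g₀₁`, `(g⁻¹)₁₀ = σ g₁₀`, `(g⁻¹)₁₁ = σ g₀₀` (a left inverse of a square matrix is its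
inverse). [cite: Rogawski1990, §1.9 p. 8] -/
theorem coe_inv_apply_of_mem_unitaryGroupOfForm_antidiagTwo {g : GL (Fin 2) K} (hg : g ∈ unitaryGroupOfForm σ !![(0 : K), 1; 1, 0]) :
    ((g⁻¹ : GL (Fin 2) K) 0 0 : K) = σ (g 1 1) ∧ ((g⁻¹ : GL (Fin 2) K) 0 1 : K) = σ (g 0 1) ∧
      ((g⁻¹ : GL (Fin 2) K) 1 0 : K) = σ (g 1 0) ∧ ((g⁻¹ : GL (Fin 2) K) 1 1 : K) = σ (g 0 0) := by
  have hU : (((g : Matrix (Fin 2) (Fin 2) K)).map σ)ᵀ * !![(0 : K), 1; 1, 0] * (g : Matrix (Fin 2) (Fin 2) K) = !![(0 : K), 1; 1, 0] := mem_unitaryGroupOfForm_iff.1 hg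
  have hΦ2 : !![(0 : K), 1; 1, 0] * !![(0 : K), 1; 1, 0] = (1 : Matrix (Fin 2) (Fin 2) K) := by
    ext i j; fin_cases i <;> fin_cases j <;> simp [Matrix.mul_apply, Fin.sum_univ_two]
  have hleft : (!![(0 : K), 1; 1, 0] * (((g : Matrix (Fin 2) (Fin 2) K)).map σ)ᵀ * !![(0 : K), 1; 1, 0]) * (g : Matrix (Fin 2) (Fin 2) K) = 1 := by
    calc (!![(0 : K), 1; 1, 0] * (((g : Matrix (Fin 2) (Fin 2) K)).map σ)ᵀ * !![(0 : K), 1; 1, 0]) * (g : Matrix (Fin 2) (Fin 2) K)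
        = !![(0 : K), 1; 1, 0] * ((((g : Matrix (Fin 2) (Fin 2) K)).map σ)ᵀ * !![(0 : K), 1; 1, 0] * (g : Matrix (Fin 2) (Fin 2) K)) := by simp only [Matrix.mul_assoc]
      _ = 1 := by rw [hU, hΦ2]
  have hinv : ((g⁻¹ : GL (Fin 2) K) : Matrix (Fin 2) (Fin 2) K) = !![(0 : K), 1; 1, 0] * (((g : Matrix (Fin 2) (Fin 2) K)).map σ)ᵀ * !![(0 : K), 1; 1, 0] := by
    rw [Matrix.coe_units_inv]; exact Matrix.inv_eq_left_inv hleft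
  have hprod : !![(0 : K), 1; 1, 0] * (((g : Matrix (Fin 2) (Fin 2) K)).map σ)ᵀ * !![(0 : K), 1; 1, 0] = !![σ (g 1 1), σ (g 0 1); σ (g 1 0), σ (g 0 0)] := by
    ext i j
    fin_cases i <;> fin_cases j <;>
      simp only [Matrix.mul_apply, Matrix.transpose_apply, Matrix.map_apply, Fin.sum_univ_two, Matrix.of_apply, Matrix.cons_val', Matrix.cons_val_zero,
        Matrix.cons_val_one, Matrix.empty_val', Matrix.cons_val_fin_one, Fin.isValue, Fin.mk_zero, Fin.mk_one] <;> simp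
  have h : ∀ i j : Fin 2, ((g⁻¹ : GL (Fin 2) K) i j : K) = (!![σ (g 1 1), σ (g 0 1); σ (g 1 0), σ (g 0 0)] : Matrix (Fin 2) (Fin 2) K) i j := fun i j => by
    rw [← hprod, ← hinv]
  exact ⟨by rw [h]; rfl, by rw [h]; rfl, by rw [h]; rfl, by rw [h]; rfl⟩

end Inverse

/-! ## §2 The one-parameter homomorphisms `n`, `n̄`, `t` -/

section OneParameter

variable {K : Type*} [Field K] (σ : K →+* K)

/-- **The upper unipotent homomorphism `n : (K, +) → GL₂(K)`, `x ↦ (1 x; 0 1)`** (existence, injectivity, entries). [cite: Rogawski1990, §1.10 p. 9] -/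
theorem exists_upperUnipotentHom :
    ∃ n : Multiplicative K →* GL (Fin 2) K, Function.Injective n ∧ ∀ x : Multiplicative K, ((n x : GL (Fin 2) K) : Matrix (Fin 2) (Fin 2) K) = !![(1 : K), Multiplicative.toAdd x; 0, 1] := by
  have hdet : ∀ x : K, (!![(1 : K), x; 0, 1]).det ≠ 0 := fun x => by rw [Matrix.det_fin_two_of]; simp
  let n₀ : Multiplicative K → GL (Fin 2) K := fun x => Matrix.GeneralLinearGroup.mkOfDetNeZero _ (hdet (Multiplicative.toAdd x))
  have hn₀ : ∀ x, ((n₀ x : GL (Fin 2) K) : Matrix (Fin 2) (Fin 2) K) = !![(1 : K), Multiplicative.toAdd x; 0, 1] := fun _ => rfl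
  refine ⟨{ toFun := n₀, map_one' := ?_, map_mul' := ?_ }, ?_, fun x => rfl⟩
  · refine Units.ext ?_
    rw [hn₀, toAdd_one, Units.val_one]
    ext i j; fin_cases i <;> fin_cases j <;> simp
  · intro x y
    refine Units.ext ?_
    rw [Units.val_mul, hn₀, hn₀, hn₀, toAdd_mul]
    ext i j; fin_cases i <;> fin_cases j <;> simp [Matrix.mul_apply, Fin.sum_univ_two, add_comm]
  · intro x y h
    have h' := congrArg (fun g : GL (Fin 2) K => ((g : Matrix (Fin 2) (Fin 2) K) 0 1)) h
    simp only [MonoidHom.coe_mk, OneHom.coe_mk, hn₀] at h'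
    simpa using h'

/-- **The lower unipotent homomorphism `n̄ : (K, +) → GL₂(K)`, `x ↦ (1 0; x 1)`** (existence, injectivity, entries). [cite: Rogawski1990, §1.10 p. 9] -/
theorem exists_lowerUnipotentHom :
    ∃ n : Multiplicative K →* GL (Fin 2) K, Function.Injective n ∧ ∀ x : Multiplicative K, ((n x : GL (Fin 2) K) : Matrix (Fin 2) (Fin 2) K) = !![(1 : K), 0; Multiplicative.toAdd x, 1] := by
  have hdet : ∀ x : K, (!![(1 : K), 0; x, 1]).det ≠ 0 := fun x => by rw [Matrix.det_fin_two_of]; simp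
  let n₀ : Multiplicative K → GL (Fin 2) K := fun x => Matrix.GeneralLinearGroup.mkOfDetNeZero _ (hdet (Multiplicative.toAdd x))
  have hn₀ : ∀ x, ((n₀ x : GL (Fin 2) K) : Matrix (Fin 2) (Fin 2) K) = !![(1 : K), 0; Multiplicative.toAdd x, 1] := fun _ => rfl
  refine ⟨{ toFun := n₀, map_one' := ?_, map_mul' := ?_ }, ?_, fun x => rfl⟩
  · refine Units.ext ?_
    rw [hn₀, toAdd_one, Units.val_one]
    ext i j; fin_cases i <;> fin_cases j <;> simp
  · intro x y
    refine Units.ext ?_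
    rw [Units.val_mul, hn₀, hn₀, hn₀, toAdd_mul]
    ext i j; fin_cases i <;> fin_cases j <;> simp [Matrix.mul_apply, Fin.sum_univ_two, add_comm]
  · intro x y h
    have h' := congrArg (fun g : GL (Fin 2) K => ((g : Matrix (Fin 2) (Fin 2) K) 1 0)) h
    simp only [MonoidHom.coe_mk, OneHom.coe_mk, hn₀] at h'
    simpa using h'

/-- **The torus homomorphism `t : K^× → GL₂(K)`, `e ↦ diag(e, (σe)⁻¹)`** (existence, injectivity, entries; `σ` a ring homomorphism). [cite: Rogawski1990, §1.10 p. 9] -/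
theorem exists_torusHom :
    ∃ t : Kˣ →* GL (Fin 2) K, Function.Injective t ∧ ∀ e : Kˣ, ((t e : GL (Fin 2) K) : Matrix (Fin 2) (Fin 2) K) = !![(e : K), 0; 0, (σ e)⁻¹] := by
  have hdet : ∀ e : Kˣ, (!![(e : K), 0; 0, (σ e)⁻¹]).det ≠ 0 := fun e => by
    rw [Matrix.det_fin_two_of]; simp [e.ne_zero, (map_ne_zero σ).2 e.ne_zero]
  let t₀ : Kˣ → GL (Fin 2) K := fun e => Matrix.GeneralLinearGroup.mkOfDetNeZero _ (hdet e)
  have ht₀ : ∀ e, ((t₀ e : GL (Fin 2) K) : Matrix (Fin 2) (Fin 2) K) = !![(e : K), 0; 0, (σ e)⁻¹] := fun _ => rfl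
  refine ⟨{ toFun := t₀, map_one' := ?_, map_mul' := ?_ }, ?_, fun e => rfl⟩
  · refine Units.ext ?_
    rw [ht₀, Units.val_one, Units.val_one, map_one, inv_one]
    ext i j; fin_cases i <;> fin_cases j <;> simp
  · intro x y
    refine Units.ext ?_
    rw [Units.val_mul, ht₀, ht₀, ht₀, Units.val_mul, map_mul, mul_inv]
    ext i j; fin_cases i <;> fin_cases j <;> simp [Matrix.mul_apply, Fin.sum_univ_two, mul_comm]
  · intro x y h
    have h' := congrArg (fun g : GL (Fin 2) K => ((g : Matrix (Fin 2) (Fin 2) K) 0 0)) h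
    simp only [MonoidHom.coe_mk, OneHom.coe_mk, ht₀] at h'
    exact Units.ext (by simpa using h')

/-- **`n(x) ∈ U(σ, antidiag(1,1)) ↔ σx = −x`** for `n(x) = (1 x; 0 1)`. [cite: Rogawski1990, §1.10 p. 9] -/
theorem upper_mem_unitaryGroupOfForm_antidiagTwo_iff {g : GL (Fin 2) K} {x : K} (hg : (g : Matrix (Fin 2) (Fin 2) K) = !![(1 : K), x; 0, 1]) :
    g ∈ unitaryGroupOfForm σ !![(0 : K), 1; 1, 0] ↔ σ x = -x := by
  have hdet : (g : Matrix (Fin 2) (Fin 2) K).det = 1 := by rw [hg, Matrix.det_fin_two_of]; ring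
  have h01 : (g 0 1 : K) = x := by rw [show (g 0 1 : K) = (g : Matrix (Fin 2) (Fin 2) K) 0 1 from rfl, hg]; rfl
  constructor
  · intro h
    obtain ⟨-, -, h3, -⟩ := map_apply_of_mem_unitaryGroupOfForm_antidiagTwo_of_det_eq_one σ h hdet
    rwa [h01] at h3
  · intro h
    refine mem_unitaryGroupOfForm_antidiagTwo_of_det_eq_one_of_map_apply σ hdet ?_ ?_ ?_ ?_ <;>
      simp [hg, h]

/-- **`n̄(x) ∈ U(σ, antidiag(1,1)) ↔ σx = −x`** for `n̄(x) = (1 0; x 1)`. [cite: Rogawski1990, §1.10 p. 9] -/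
theorem lower_mem_unitaryGroupOfForm_antidiagTwo_iff {g : GL (Fin 2) K} {x : K} (hg : (g : Matrix (Fin 2) (Fin 2) K) = !![(1 : K), 0; x, 1]) :
    g ∈ unitaryGroupOfForm σ !![(0 : K), 1; 1, 0] ↔ σ x = -x := by
  have hdet : (g : Matrix (Fin 2) (Fin 2) K).det = 1 := by rw [hg, Matrix.det_fin_two_of]; ring
  have h10 : (g 1 0 : K) = x := by rw [show (g 1 0 : K) = (g : Matrix (Fin 2) (Fin 2) K) 1 0 from rfl, hg]; rfl
  constructor
  · intro h
    obtain ⟨-, -, -, h4⟩ := map_apply_of_mem_unitaryGroupOfForm_antidiagTwo_of_det_eq_one σ h hdet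
    rwa [h10] at h4
  · intro h
    refine mem_unitaryGroupOfForm_antidiagTwo_of_det_eq_one_of_map_apply σ hdet ?_ ?_ ?_ ?_ <;>
      simp [hg, h]

/-- **`t(e) = diag(e, (σe)⁻¹) ∈ U(σ, antidiag(1,1))`** for `σ` an involution. [cite: Rogawski1990, §1.10 p. 9] -/
theorem torus_mem_unitaryGroupOfForm_antidiagTwo (hσ : ∀ x, σ (σ x) = x) {g : GL (Fin 2) K} (e : Kˣ) (hg : (g : Matrix (Fin 2) (Fin 2) K) = !![(e : K), 0; 0, (σ e)⁻¹]) :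
    g ∈ unitaryGroupOfForm σ !![(0 : K), 1; 1, 0] :=
  (diag_mem_unitaryGroupOfForm_antidiagTwo σ hσ e.ne_zero hg).1

end OneParameter

/-! ## §3 The level subgroups `K⁰ ⊇ I ⊇ B(4) ⊇ N(𝒪⁻)K(4) ⊇ K(4)` as `{g ∈ U | entry conditions}` -/

section Levels

variable {K : Type*} [Field K] (σ : K →+* K) [Valued K ℤᵐ⁰] (hvσ : ∀ x, Valued.v (σ x) = Valued.v x)

omit [Valued K ℤᵐ⁰] in
/-- Entries of a product of `2 × 2` matrices in `GL₂(K)`. [cite: Rogawski1990, §1.9 p. 8] -/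
theorem coe_mul_apply_two (g h : GL (Fin 2) K) (i j : Fin 2) : ((g * h : GL (Fin 2) K) i j : K) = (g i 0 : K) * h 0 j + (g i 1 : K) * h 1 j := by
  rw [show ((g * h : GL (Fin 2) K) i j : K) = ((g : Matrix (Fin 2) (Fin 2) K) * (h : Matrix (Fin 2) (Fin 2) K)) i j by rw [← Units.val_mul], Matrix.mul_apply, Fin.sum_univ_two]

/-- **Products of integral matrices are integral**: `|(gh)ᵢⱼ| ≤ 1` when all `|gᵢⱼ|, |hᵢⱼ| ≤ 1`. [cite: Tits1979, §3.7] -/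
theorem valued_coe_mul_apply_le_one {g h : GL (Fin 2) K} (hgi : ∀ i j, Valued.v (g i j : K) ≤ 1) (hhi : ∀ i j, Valued.v (h i j : K) ≤ 1) (i j : Fin 2) :
    Valued.v ((g * h : GL (Fin 2) K) i j : K) ≤ 1 := by
  rw [coe_mul_apply_two]
  refine (Valuation.map_add _ _ _).trans (max_le ?_ ?_) <;> rw [map_mul] <;> exact mul_le_one' (hgi _ _) (hhi _ _)

include hvσ in
/-- **`K⁰ := U ∩ GL₂(𝒪)` EXISTS as a subgroup** (letter: `g ∈ U ∧ ∀ i j, |gᵢⱼ| ≤ 1`): closed under products (ultrametric) and inverses (`(g⁻¹)ᵢⱼ = σ g_{j'i'}`, `|σx| = |x|`).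
[cite: Tits1979, §3.7, §3.9] -/
theorem exists_subgroup_integralLevel :
    ∃ K0 : Subgroup (GL (Fin 2) K), ∀ g, g ∈ K0 ↔ g ∈ unitaryGroupOfForm σ !![(0 : K), 1; 1, 0] ∧ ∀ i j, Valued.v (g i j : K) ≤ 1 := by
  refine ⟨{ carrier := {g | g ∈ unitaryGroupOfForm σ !![(0 : K), 1; 1, 0] ∧ ∀ i j, Valued.v (g i j : K) ≤ 1}
            mul_mem' := fun {g h} hg hh => ⟨Subgroup.mul_mem _ hg.1 hh.1, valued_coe_mul_apply_le_one hg.2 hh.2⟩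
            one_mem' := ⟨Subgroup.one_mem _, fun i j => by fin_cases i <;> fin_cases j <;> simp⟩
            inv_mem' := fun {g} hg => ⟨Subgroup.inv_mem _ hg.1, ?_⟩ }, fun _ => Iff.rfl⟩
  obtain ⟨h00, h01, h10, h11⟩ := coe_inv_apply_of_mem_unitaryGroupOfForm_antidiagTwo σ hg.1
  intro i j
  fin_cases i <;> fin_cases j
  · simpa [h00, hvσ] using hg.2 1 1
  · simpa [h01, hvσ] using hg.2 0 1
  · simpa [h10, hvσ] using hg.2 1 0
  · simpa [h11, hvσ] using hg.2 0 0

include hvσ in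
/-- **THE IWAHORI SUBGROUP `I := {k ∈ K⁰ : |k₁₀| < 1}` EXISTS as a subgroup** (`(kk′)₁₀ = k₁₀k′₀₀ + k₁₁k′₁₀`, `(k⁻¹)₁₀ = σ k₁₀`). [cite: Tits1979, §3.7] [cite: CartierCorvallis1979, §III.5] -/
theorem exists_subgroup_iwahori :
    ∃ I : Subgroup (GL (Fin 2) K), ∀ g, g ∈ I ↔ (g ∈ unitaryGroupOfForm σ !![(0 : K), 1; 1, 0] ∧ ∀ i j, Valued.v (g i j : K) ≤ 1) ∧ Valued.v (g 1 0 : K) < 1 := by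
  obtain ⟨K0, hK0⟩ := exists_subgroup_integralLevel σ hvσ
  refine ⟨{ carrier := {g | g ∈ K0 ∧ Valued.v (g 1 0 : K) < 1}
            mul_mem' := fun {g h} hg hh => ⟨K0.mul_mem hg.1 hh.1, ?_⟩
            one_mem' := ⟨K0.one_mem, by simp⟩
            inv_mem' := fun {g} hg => ⟨K0.inv_mem hg.1, ?_⟩ }, fun g => by change g ∈ K0 ∧ _ ↔ _; rw [hK0]⟩
  · rw [coe_mul_apply_two]
    refine lt_of_le_of_lt (Valuation.map_add _ _ _) (max_lt ?_ ?_) <;> rw [map_mul]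
    · exact mul_lt_one_of_nonneg_of_lt_one_left zero_le hg.2 (((hK0 h).1 hh.1).2 0 0)
    · exact mul_lt_one_of_nonneg_of_lt_one_right (((hK0 g).1 hg.1).2 1 1) zero_le hh.2
  · obtain ⟨-, -, h10, -⟩ := coe_inv_apply_of_mem_unitaryGroupOfForm_antidiagTwo σ ((hK0 g).1 hg.1).1
    rw [h10, hvσ]; exact hg.2

include hvσ in
/-- **THE LEVEL `B(4) := {k ∈ K⁰ : |k₁₀| ≤ |4|}` (upper triangular modulo `4`) EXISTS as a subgroup.** [cite: Tits1979, §3.7] [cite: CartierCorvallis1979, §III.5] -/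
theorem exists_subgroup_borelLevel :
    ∃ H : Subgroup (GL (Fin 2) K), ∀ g, g ∈ H ↔ (g ∈ unitaryGroupOfForm σ !![(0 : K), 1; 1, 0] ∧ ∀ i j, Valued.v (g i j : K) ≤ 1) ∧ Valued.v (g 1 0 : K) ≤ Valued.v (4 : K) := by
  obtain ⟨K0, hK0⟩ := exists_subgroup_integralLevel σ hvσ
  refine ⟨{ carrier := {g | g ∈ K0 ∧ Valued.v (g 1 0 : K) ≤ Valued.v (4 : K)}
            mul_mem' := fun {g h} hg hh => ⟨K0.mul_mem hg.1 hh.1, ?_⟩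
            one_mem' := ⟨K0.one_mem, by simp⟩
            inv_mem' := fun {g} hg => ⟨K0.inv_mem hg.1, ?_⟩ }, fun g => by change g ∈ K0 ∧ _ ↔ _; rw [hK0]⟩
  · rw [coe_mul_apply_two]
    refine (Valuation.map_add _ _ _).trans (max_le ?_ ?_) <;> rw [map_mul]
    · exact (mul_le_of_le_one_right' (((hK0 h).1 hh.1).2 0 0)).trans hg.2
    · exact (mul_le_of_le_one_left' (((hK0 g).1 hg.1).2 1 1)).trans hh.2
  · obtain ⟨-, -, h10, -⟩ := coe_inv_apply_of_mem_unitaryGroupOfForm_antidiagTwo σ ((hK0 g).1 hg.1).1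
    rw [h10, hvσ]; exact hg.2

include hvσ in
/-- **THE LEVEL `N(𝒪⁻)·K(4) := {k ∈ K⁰ : k₀₀ ≡ k₁₁ ≡ 1, k₁₀ ≡ 0 (mod 4)}` (upper UNItriangular modulo `4`) EXISTS as a subgroup** (`(kk′)₀₀ − 1 = (k₀₀ − 1)k′₀₀ + (k′₀₀ − 1) + k₀₁k′₁₀`,
`(k⁻¹)₀₀ = σ k₁₁`, …). [cite: Tits1979, §3.7] [cite: CartierCorvallis1979, §III.5] -/
theorem exists_subgroup_unitriangularLevel :
    ∃ H : Subgroup (GL (Fin 2) K), ∀ g, g ∈ H ↔ (g ∈ unitaryGroupOfForm σ !![(0 : K), 1; 1, 0] ∧ ∀ i j, Valued.v (g i j : K) ≤ 1) ∧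
      Valued.v ((g 0 0 : K) - 1) ≤ Valued.v (4 : K) ∧ Valued.v ((g 1 1 : K) - 1) ≤ Valued.v (4 : K) ∧ Valued.v (g 1 0 : K) ≤ Valued.v (4 : K) := by
  obtain ⟨K0, hK0⟩ := exists_subgroup_integralLevel σ hvσ
  refine ⟨{ carrier := {g | g ∈ K0 ∧ Valued.v ((g 0 0 : K) - 1) ≤ Valued.v (4 : K) ∧ Valued.v ((g 1 1 : K) - 1) ≤ Valued.v (4 : K) ∧ Valued.v (g 1 0 : K) ≤ Valued.v (4 : K)}
            mul_mem' := fun {g h} hg hh => ⟨K0.mul_mem hg.1 hh.1, ?_, ?_, ?_⟩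
            one_mem' := ⟨K0.one_mem, by simp, by simp, by simp⟩
            inv_mem' := fun {g} hg => ⟨K0.inv_mem hg.1, ?_⟩ }, fun g => by change g ∈ K0 ∧ _ ↔ _; rw [hK0]⟩
  · have hgi := ((hK0 g).1 hg.1).2; have hhi := ((hK0 h).1 hh.1).2
    rw [coe_mul_apply_two, show (g 0 0 : K) * h 0 0 + (g 0 1 : K) * h 1 0 - 1 = ((g 0 0 : K) - 1) * h 0 0 + ((h 0 0 : K) - 1) + (g 0 1 : K) * h 1 0 by ring]
    refine (Valuation.map_add _ _ _).trans (max_le ((Valuation.map_add _ _ _).trans (max_le ?_ hh.2.1)) ?_) <;> rw [map_mul]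
    · exact (mul_le_of_le_one_right' (hhi 0 0)).trans hg.2.1
    · exact (mul_le_of_le_one_left' (hgi 0 1)).trans hh.2.2.2
  · have hgi := ((hK0 g).1 hg.1).2; have hhi := ((hK0 h).1 hh.1).2
    rw [coe_mul_apply_two, show (g 1 0 : K) * h 0 1 + (g 1 1 : K) * h 1 1 - 1 = (g 1 0 : K) * h 0 1 + (((g 1 1 : K) - 1) * h 1 1 + ((h 1 1 : K) - 1)) by ring]
    refine (Valuation.map_add _ _ _).trans (max_le ?_ ((Valuation.map_add _ _ _).trans (max_le ?_ hh.2.2.1))) <;> rw [map_mul]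
    · exact (mul_le_of_le_one_right' (hhi 0 1)).trans hg.2.2.2
    · exact (mul_le_of_le_one_right' (hhi 1 1)).trans hg.2.2.1
  · have hgi := ((hK0 g).1 hg.1).2; have hhi := ((hK0 h).1 hh.1).2
    rw [coe_mul_apply_two]
    refine (Valuation.map_add _ _ _).trans (max_le ?_ ?_) <;> rw [map_mul]
    · exact (mul_le_of_le_one_right' (hhi 0 0)).trans hg.2.2.2
    · exact (mul_le_of_le_one_left' (hgi 1 1)).trans hh.2.2.2
  · obtain ⟨h00, -, h10, h11⟩ := coe_inv_apply_of_mem_unitaryGroupOfForm_antidiagTwo σ ((hK0 g).1 hg.1).1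
    refine ⟨?_, ?_, ?_⟩
    · rw [h00, ← map_one σ, ← map_sub, hvσ]; exact hg.2.2.1
    · rw [h11, ← map_one σ, ← map_sub, hvσ]; exact hg.2.1
    · rw [h10, hvσ]; exact hg.2.2.2

include hvσ in
/-- **THE PRINCIPAL LEVEL `K(4) := {k ∈ K⁰ : k ≡ 1 (mod 4)}` EXISTS as a subgroup** (all four congruences; closure as for the unitriangular level). [cite: Tits1979, §3.7] -/
theorem exists_subgroup_principalLevel :
    ∃ H : Subgroup (GL (Fin 2) K), ∀ g, g ∈ H ↔ (g ∈ unitaryGroupOfForm σ !![(0 : K), 1; 1, 0] ∧ ∀ i j, Valued.v (g i j : K) ≤ 1) ∧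
      ∀ i j, Valued.v ((g i j : K) - (1 : Matrix (Fin 2) (Fin 2) K) i j) ≤ Valued.v (4 : K) := by
  obtain ⟨K0, hK0⟩ := exists_subgroup_integralLevel σ hvσ
  -- integral matrices congruent to `1` modulo `4` are stable under products
  have hmul : ∀ g h : GL (Fin 2) K, (∀ i j, Valued.v (g i j : K) ≤ 1) → (∀ i j, Valued.v (h i j : K) ≤ 1) →
      (∀ i j, Valued.v ((g i j : K) - (1 : Matrix (Fin 2) (Fin 2) K) i j) ≤ Valued.v (4 : K)) → (∀ i j, Valued.v ((h i j : K) - (1 : Matrix (Fin 2) (Fin 2) K) i j) ≤ Valued.v (4 : K)) →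
      ∀ i j, Valued.v (((g * h : GL (Fin 2) K) i j : K) - (1 : Matrix (Fin 2) (Fin 2) K) i j) ≤ Valued.v (4 : K) := by
    intro g h hgi hhi hg hh i j
    -- `(gh − 1)ᵢⱼ = Σ_k (g − 1)ᵢₖ hₖⱼ + (h − 1)ᵢⱼ`
    have hid : ((g * h : GL (Fin 2) K) i j : K) - (1 : Matrix (Fin 2) (Fin 2) K) i j =
        (((g i 0 : K) - (1 : Matrix (Fin 2) (Fin 2) K) i 0) * h 0 j + ((g i 1 : K) - (1 : Matrix (Fin 2) (Fin 2) K) i 1) * h 1 j) + ((h i j : K) - (1 : Matrix (Fin 2) (Fin 2) K) i j) := by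
      rw [coe_mul_apply_two]
      fin_cases i <;> fin_cases j <;> simp [Matrix.one_apply] <;> ring
    rw [hid]
    refine (Valuation.map_add _ _ _).trans (max_le ((Valuation.map_add _ _ _).trans (max_le ?_ ?_)) (hh i j)) <;> rw [map_mul]
    · exact (mul_le_of_le_one_right' (hhi 0 j)).trans (hg i 0)
    · exact (mul_le_of_le_one_right' (hhi 1 j)).trans (hg i 1)
  refine ⟨{ carrier := {g | g ∈ K0 ∧ ∀ i j, Valued.v ((g i j : K) - (1 : Matrix (Fin 2) (Fin 2) K) i j) ≤ Valued.v (4 : K)}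
            mul_mem' := fun {g h} hg hh => ⟨K0.mul_mem hg.1 hh.1, hmul g h ((hK0 g).1 hg.1).2 ((hK0 h).1 hh.1).2 hg.2 hh.2⟩
            one_mem' := ⟨K0.one_mem, fun i j => by simp⟩
            inv_mem' := fun {g} hg => ⟨K0.inv_mem hg.1, ?_⟩ }, fun g => by change g ∈ K0 ∧ _ ↔ _; rw [hK0]⟩
  obtain ⟨h00, h01, h10, h11⟩ := coe_inv_apply_of_mem_unitaryGroupOfForm_antidiagTwo σ ((hK0 g).1 hg.1).1
  intro i j
  fin_cases i <;> fin_cases j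
  · have h' := hg.2 1 1
    rw [Matrix.one_apply_eq] at h'
    show Valued.v (((g⁻¹ : GL (Fin 2) K) 0 0 : K) - (1 : Matrix (Fin 2) (Fin 2) K) 0 0) ≤ Valued.v (4 : K)
    rw [h00, Matrix.one_apply_eq, ← map_one σ, ← map_sub, hvσ]; exact h'
  · simpa [h01, hvσ, Matrix.one_apply] using hg.2 0 1
  · simpa [h10, hvσ, Matrix.one_apply] using hg.2 1 0
  · have h' := hg.2 0 0
    rw [Matrix.one_apply_eq] at h'
    show Valued.v (((g⁻¹ : GL (Fin 2) K) 1 1 : K) - (1 : Matrix (Fin 2) (Fin 2) K) 1 1) ≤ Valued.v (4 : K)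
    rw [h11, Matrix.one_apply_eq, ← map_one σ, ← map_sub, hvσ]; exact h'

/-- **THE CHAIN `K(4) ≤ N(𝒪⁻)K(4) ≤ B(4) ≤ I`** when `|4| < 1` (the letters imply one another). [cite: CartierCorvallis1979, §III.5] -/
theorem principalLevel_le_unitriangularLevel_le_borelLevel_le_iwahori (h4 : Valued.v (4 : K) < 1)
    {K4 H1 H2 I : Subgroup (GL (Fin 2) K)}
    (hK4 : ∀ g, g ∈ K4 ↔ (g ∈ unitaryGroupOfForm σ !![(0 : K), 1; 1, 0] ∧ ∀ i j, Valued.v (g i j : K) ≤ 1) ∧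
      ∀ i j, Valued.v ((g i j : K) - (1 : Matrix (Fin 2) (Fin 2) K) i j) ≤ Valued.v (4 : K))
    (hH1 : ∀ g, g ∈ H1 ↔ (g ∈ unitaryGroupOfForm σ !![(0 : K), 1; 1, 0] ∧ ∀ i j, Valued.v (g i j : K) ≤ 1) ∧
      Valued.v ((g 0 0 : K) - 1) ≤ Valued.v (4 : K) ∧ Valued.v ((g 1 1 : K) - 1) ≤ Valued.v (4 : K) ∧ Valued.v (g 1 0 : K) ≤ Valued.v (4 : K))
    (hH2 : ∀ g, g ∈ H2 ↔ (g ∈ unitaryGroupOfForm σ !![(0 : K), 1; 1, 0] ∧ ∀ i j, Valued.v (g i j : K) ≤ 1) ∧ Valued.v (g 1 0 : K) ≤ Valued.v (4 : K))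
    (hI : ∀ g, g ∈ I ↔ (g ∈ unitaryGroupOfForm σ !![(0 : K), 1; 1, 0] ∧ ∀ i j, Valued.v (g i j : K) ≤ 1) ∧ Valued.v (g 1 0 : K) < 1) :
    K4 ≤ H1 ∧ H1 ≤ H2 ∧ H2 ≤ I := by
  refine ⟨fun g hg => ?_, fun g hg => ?_, fun g hg => ?_⟩
  · obtain ⟨hg0, hg1⟩ := (hK4 g).1 hg
    refine (hH1 g).2 ⟨hg0, ?_, ?_, ?_⟩
    · simpa [Matrix.one_apply] using hg1 0 0
    · simpa [Matrix.one_apply] using hg1 1 1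
    · simpa [Matrix.one_apply] using hg1 1 0
  · obtain ⟨hg0, -, -, hg10⟩ := (hH1 g).1 hg
    exact (hH2 g).2 ⟨hg0, hg10⟩
  · obtain ⟨hg0, hg10⟩ := (hH2 g).1 hg
    exact (hI g).2 ⟨hg0, hg10.trans_lt h4⟩

end Levels

end UnitaryGroup

end Literature.NumberTheory.Automorphic
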